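import Summits.QuantumFields.YangMills.Theorems.LuscherReductionDressedRitzLiftPositionDirichlet
import Summits.QuantumFields.YangMills.Theorems.LuscherReductionDressedRitzPolyakovLiftEuclideanCurrencySlab
import Summits.QuantumFields.YangMills.Theorems.LuscherReductionDressedRitzLiftLeakageSymmetry
import HarnessLib

/-!
# Crux `DressedRitz` (stmt-QuantumFields-20205), line «polyakovlift» r5, stubs S-PSCAL (`stub_pscaling`, W1-A) ∕ S-LEAK (W1-C) — support:
# the JUMP ∕ DIRICHLET CURRENCY of a QUASIMODE RESIDUAL — `‖(K_β − a)(Oφ)‖² = (λ₀ − a)²‖Oφ‖² + a·D₁(O) − ½·D₂(O)`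

Support module (stub worker ym-20205-polyakovlift-w1a g0; `--supports stmt-QuantumFields-20205`, helper, no closure claim).  After
`…PolyakovLiftShadowQuasimodeUndressed.lean` (p554020) the S-PSCAL target is ONE quasimode inequality per channel,
`‖(K_B − a)v‖² ≤ (C(Λ²/L)μ₀)²‖v‖²` for `v = ins_{e₀}(g ∘ powLink L)`; W1-C's residual law (RL′) is a bound of the same shape.  This file is the
SECOND-MOMENT companion of the lead's Dirichlet identity (`LiftPos.increment_sq_eq`: `⟨Oφ, K_β(Oφ)⟩ = λ₀‖Oφ‖² − ½D₁(O)`): for a physical top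
eigenvector `φ` (`K_βφ = λ₀φ`) and a physical insertion `O`,

* §1 `inner_increment_sq_twoStep`, ★ `increment_sq_twoStep_eq`:  `½·D₂(O) = λ₀²‖Oφ‖² − ‖K_β(Oφ)‖²`, where
  `D₂(O) = ∫_W ∬ K_β(W,U)K_β(W,V) φ(U)φ(V) (O(U) − O(V))² dU dV dW` is the THREE-slice (two-step) vacuum expectation of the squared increment
  (expand the square at fixed `W`; `K_βφ = λ₀φ` twice and the symmetry of `K_β`);
* §2 (with the tree's `LiftLeak.residual_expand`) ★★ `residual_eq_dirichlet`:
  `‖K_β(Oφ) − a·(Oφ)‖² = (λ₀ − a)²‖Oφ‖² + a·D₁(O) − ½·D₂(O)`, and ★★ `residual_ins_eq_dirichlet`: the same for the vacuum-subtracted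
  `v = ins φ O` (`‖φ‖ = 1`; the constant drops out of both jump forms) —
  `φ` enters ONLY as a positive weight (no pointwise regularity of the exact vacuum), `O` only through its increments.

So `ShadowQuasimodeAt` (one-site, `φ = e₀`, `O = g_i ∘ powLink L`, `a ≈ μ_{i+1}(B)`) reads: `½D₂ − aD₁ = (μ₀ − a)²‖v‖² + O(Λ⁴/L²)μ₀²‖v‖²` — a
second-order relation between the one- and two-step quadratic variations of the scaled eigen-ratio under the one-site vacuum slice laws.
HONEST FRAMING: fixed-lattice identities on the conditional femto rung R2b1; no semiclassics, no RG; `stub_pscaling`, `stub_liftLeakage` stay OPEN;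
no mass-gap ∕ continuum ∕ Clay claim.  References: E. Seiler, LNP 159 (1982) §3 [cite: SeilerLNP1982, §3]; T. Kato (1949) [cite: Kato1949, §1].
-/

set_option autoImplicit false

noncomputable section

open MeasureTheory Filter Topology Real
open Literature.MathematicalPhysics.QuantumFieldTheory
open Literature.MathematicalPhysics.QuantumLattice
open scoped BigOperators

namespace Summit.QuantumFields.YangMills.Theorems.FemtoTransferGap.LiftPos

open Summit.QuantumFields.YangMills.Theorems.FemtoTransferGap
open Summit.QuantumFields.YangMills.Theorems.FemtoTransferGap.OpPlat

section Femto

variable {L : ℕ} [NeZero L]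

/-! ## §1 The two-step (three-slice) expectation of the squared increment -/

/-- Fixed middle slice `W`: `∫_U ∫_V K_β(W,U)K_β(W,V)φ(U)φ(V)(O U − O V)² = 2·[(K_βφ)(W)·(K_β(O²φ))(W) − (K_β(Oφ))(W)²]` (expand the square; only
single `V`-integrals occur). [folklore] -/
theorem inner_increment_sq_twoStep (β : ℝ) {φ O : GaugeConfig 3 L SU2 → ℝ} (hφ : IsPhys φ) (hO : IsPhys O) (W : GaugeConfig 3 L SU2) :
    ∫ U, ∫ V, transferKernel su2Rep β W U * transferKernel su2Rep β W V * (φ U * φ V) * (O U - O V) ^ 2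
        ∂(configMeasure SU2 L) ∂(configMeasure SU2 L) =
      2 * (transferApply β φ W * transferApply β (O * O * φ) W - transferApply β (O * φ) W ^ 2) := by
  have hOφ : IsPhys (O * φ) := isPhys_mul hO hφ
  have hOOφ : IsPhys (O * O * φ) := isPhys_mul (isPhys_mul hO hO) hφ
  obtain ⟨C₁, hC₁⟩ := hφ.bounded
  obtain ⟨C₂, hC₂⟩ := hOφ.bounded
  obtain ⟨C₃, hC₃⟩ := hOOφ.bounded
  have i₁ := integrable_transferKernel_mul β W hφ.measurable hC₁
  have i₂ := integrable_transferKernel_mul β W hOφ.measurable hC₂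
  have i₃ := integrable_transferKernel_mul β W hOOφ.measurable hC₃
  -- the inner `V`-integral at fixed `U`
  have hinner : ∀ U, ∫ V, transferKernel su2Rep β W U * transferKernel su2Rep β W V * (φ U * φ V) * (O U - O V) ^ 2
      ∂(configMeasure SU2 L) =
      transferKernel su2Rep β W U * φ U *
        (O U ^ 2 * transferApply β φ W - 2 * O U * transferApply β (O * φ) W + transferApply β (O * O * φ) W) := by
    intro U
    have hpt : ∀ V, transferKernel su2Rep β W U * transferKernel su2Rep β W V * (φ U * φ V) * (O U - O V) ^ 2 =
        transferKernel su2Rep β W U * φ U *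
          (O U ^ 2 * (transferKernel su2Rep β W V * φ V) - 2 * O U * (transferKernel su2Rep β W V * (O * φ) V)
            + transferKernel su2Rep β W V * (O * O * φ) V) := fun V => by
      simp only [Pi.mul_apply]; ring
    simp_rw [hpt]
    rw [integral_const_mul]
    congr 1
    have iA : Integrable (fun V => O U ^ 2 * (transferKernel su2Rep β W V * φ V)) (configMeasure SU2 L) := i₁.const_mul _
    have iB : Integrable (fun V => 2 * O U * (transferKernel su2Rep β W V * (O * φ) V)) (configMeasure SU2 L) := i₂.const_mul _
    have iAB : Integrable (fun V => O U ^ 2 * (transferKernel su2Rep β W V * φ V)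
        - 2 * O U * (transferKernel su2Rep β W V * (O * φ) V)) (configMeasure SU2 L) := iA.sub iB
    rw [integral_add iAB i₃, integral_sub iA iB, integral_const_mul, integral_const_mul]
    simp only [transferApply_apply]
  simp_rw [hinner]
  -- the outer `U`-integral
  have hpt2 : ∀ U, transferKernel su2Rep β W U * φ U *
        (O U ^ 2 * transferApply β φ W - 2 * O U * transferApply β (O * φ) W + transferApply β (O * O * φ) W) =
      transferApply β φ W * (transferKernel su2Rep β W U * (O * O * φ) U)
        - 2 * transferApply β (O * φ) W * (transferKernel su2Rep β W U * (O * φ) U)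
        + transferApply β (O * O * φ) W * (transferKernel su2Rep β W U * φ U) := fun U => by
    simp only [Pi.mul_apply]; ring
  simp_rw [hpt2]
  have jA : Integrable (fun U => transferApply β φ W * (transferKernel su2Rep β W U * (O * O * φ) U)) (configMeasure SU2 L) :=
    i₃.const_mul _
  have jB : Integrable (fun U => 2 * transferApply β (O * φ) W * (transferKernel su2Rep β W U * (O * φ) U)) (configMeasure SU2 L) :=
    i₂.const_mul _
  have jC : Integrable (fun U => transferApply β (O * O * φ) W * (transferKernel su2Rep β W U * φ U)) (configMeasure SU2 L) :=
    i₁.const_mul _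
  have jAB : Integrable (fun U => transferApply β φ W * (transferKernel su2Rep β W U * (O * O * φ) U)
      - 2 * transferApply β (O * φ) W * (transferKernel su2Rep β W U * (O * φ) U)) (configMeasure SU2 L) := jA.sub jB
  rw [integral_add jAB jC, integral_sub jA jB, integral_const_mul, integral_const_mul, integral_const_mul]
  simp only [← transferApply_apply]
  ring

/-- ★ **`½·D₂(O) = λ₀²‖Oφ‖² − ‖K_β(Oφ)‖²`** for a physical top eigenvector `φ` (`K_βφ = λ₀φ`) and a physical insertion `O`:
the three-slice expectation of the squared increment is the two-step effective-mass deficit. [cite: SeilerLNP1982, §3] -/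
theorem increment_sq_twoStep_eq (β : ℝ) {φ O : GaugeConfig 3 L SU2 → ℝ} (hφ : IsPhys φ) (hO : IsPhys O)
    (heig : transferApply β φ = levelValue su2Rep L β 0 • φ) :
    (1 / 2 : ℝ) * ∫ W, ∫ U, ∫ V, transferKernel su2Rep β W U * transferKernel su2Rep β W V * (φ U * φ V) * (O U - O V) ^ 2
        ∂(configMeasure SU2 L) ∂(configMeasure SU2 L) ∂(configMeasure SU2 L) =
      levelValue su2Rep L β 0 ^ 2 * l2 (O * φ) (O * φ) - l2 (transferApply β (O * φ)) (transferApply β (O * φ)) := by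
  have hOφ : IsPhys (O * φ) := isPhys_mul hO hφ
  have hOOφ : IsPhys (O * O * φ) := isPhys_mul (isPhys_mul hO hO) hφ
  simp_rw [inner_increment_sq_twoStep β hφ hO]
  have j₁ : Integrable (fun W => (transferApply β φ * transferApply β (O * O * φ)) W) (configMeasure SU2 L) :=
    (isPhys_mul (isPhys_transferApply β hφ) (isPhys_transferApply β hOOφ)).integrable
  have j₂ : Integrable (fun W => (transferApply β (O * φ) * transferApply β (O * φ)) W) (configMeasure SU2 L) :=
    (isPhys_mul (isPhys_transferApply β hOφ) (isPhys_transferApply β hOφ)).integrable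
  have hpt : ∀ W, 2 * (transferApply β φ W * transferApply β (O * O * φ) W - transferApply β (O * φ) W ^ 2) =
      2 * ((transferApply β φ * transferApply β (O * O * φ)) W - (transferApply β (O * φ) * transferApply β (O * φ)) W) := fun W => by
    simp only [Pi.mul_apply]; ring
  simp_rw [hpt]
  rw [integral_const_mul, integral_sub j₁ j₂]
  -- `∫ (K φ)(K(O²φ)) = λ₀ ⟨φ, K(O²φ)⟩ = λ₀² ‖Oφ‖²`
  have e₁ : ∫ W, (transferApply β φ * transferApply β (O * O * φ)) W ∂(configMeasure SU2 L) =
      levelValue su2Rep L β 0 ^ 2 * l2 (O * φ) (O * φ) := by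
    have h1 : ∫ W, (transferApply β φ * transferApply β (O * O * φ)) W ∂(configMeasure SU2 L) =
        l2 (transferApply β φ) (transferApply β (O * O * φ)) := rfl
    rw [h1, heig, l2_smul_left, ← l2_transferApply_comm β hφ hOOφ, heig, l2_smul_left]
    have h2 : l2 φ (O * O * φ) = l2 (O * φ) (O * φ) := by
      unfold l2; refine integral_congr_ae (ae_of_all _ fun U => ?_); simp only [Pi.mul_apply]; ring
    rw [h2]; ring
  have e₂ : ∫ W, (transferApply β (O * φ) * transferApply β (O * φ)) W ∂(configMeasure SU2 L) =
      l2 (transferApply β (O * φ)) (transferApply β (O * φ)) := rfl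
  rw [e₁, e₂]; ring

/-! ## §2 ★★ The residual in jump currency -/

/-- ★★ **RESIDUAL = VACUUM MISMATCH + ONE-STEP − HALF TWO-STEP QUADRATIC VARIATION**: for a physical top eigenvector `φ` (`K_βφ = λ₀φ`), a
physical insertion `O` and every `a`,
`‖K_β(Oφ) − a·(Oφ)‖² = (λ₀ − a)²‖Oφ‖² + a·D₁(O) − ½·D₂(O)` with `D₁(O) = ∬(O U − O V)²φ(U)K_β(U,V)φ(V)`,
`D₂(O) = ∫_W∬ K_β(W,U)K_β(W,V)φ(U)φ(V)(O U − O V)²`. [cite: SeilerLNP1982, §3] [cite: Kato1949, §1] -/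
theorem residual_eq_dirichlet (β : ℝ) {φ O : GaugeConfig 3 L SU2 → ℝ} (hφ : IsPhys φ) (hO : IsPhys O)
    (heig : transferApply β φ = levelValue su2Rep L β 0 • φ) (a : ℝ) :
    l2 (transferApply β (O * φ) - a • (O * φ)) (transferApply β (O * φ) - a • (O * φ)) =
      (levelValue su2Rep L β 0 - a) ^ 2 * l2 (O * φ) (O * φ)
        + a * ∫ U, ∫ V, (O U - O V) ^ 2 * (φ U * transferKernel su2Rep β U V * φ V) ∂(configMeasure SU2 L) ∂(configMeasure SU2 L)
        - (1 / 2 : ℝ) * ∫ W, ∫ U, ∫ V, transferKernel su2Rep β W U * transferKernel su2Rep β W V * (φ U * φ V) * (O U - O V) ^ 2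
            ∂(configMeasure SU2 L) ∂(configMeasure SU2 L) ∂(configMeasure SU2 L) := by
  have hOφ : IsPhys (O * φ) := isPhys_mul hO hφ
  rw [LiftLeak.residual_expand β hOφ a, increment_sq_twoStep_eq β hφ hO heig]
  have h1 := increment_sq_eq β hφ hO heig
  have h1' : ∫ U, ∫ V, (O U - O V) ^ 2 * (φ U * transferKernel su2Rep β U V * φ V) ∂(configMeasure SU2 L) ∂(configMeasure SU2 L) =
      2 * (levelValue su2Rep L β 0 * l2 (O * φ) (O * φ) - l2 (O * φ) (transferApply β (O * φ))) := by linarith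
  rw [h1']; ring

/-- ★★ **The same for the vacuum-subtracted insertion** `v = ins φ O = (O − ⟨O⟩_φ)φ` (`‖φ‖ = 1`): the constant drops out of both jump forms, so
`‖K_βv − a·v‖² = (λ₀ − a)²‖v‖² + a·D₁(O) − ½·D₂(O)` — the QUASIMODE RESIDUAL of a shadow∕lift channel vector in Euclidean slice currency.
[cite: SeilerLNP1982, §3] [cite: Kato1949, §1] -/
theorem residual_ins_eq_dirichlet (β : ℝ) {φ O : GaugeConfig 3 L SU2 → ℝ} (hφ : IsPhys φ) (hO : IsPhys O)
    (heig : transferApply β φ = levelValue su2Rep L β 0 • φ) (a : ℝ) :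
    l2 (transferApply β (ins φ O) - a • ins φ O) (transferApply β (ins φ O) - a • ins φ O) =
      (levelValue su2Rep L β 0 - a) ^ 2 * l2 (ins φ O) (ins φ O)
        + a * ∫ U, ∫ V, (O U - O V) ^ 2 * (φ U * transferKernel su2Rep β U V * φ V) ∂(configMeasure SU2 L) ∂(configMeasure SU2 L)
        - (1 / 2 : ℝ) * ∫ W, ∫ U, ∫ V, transferKernel su2Rep β W U * transferKernel su2Rep β W V * (φ U * φ V) * (O U - O V) ^ 2
            ∂(configMeasure SU2 L) ∂(configMeasure SU2 L) ∂(configMeasure SU2 L) := by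
  -- `ins φ O = O' φ` with `O' = O − c`, and the increments of `O'` are those of `O`
  set c : ℝ := l2 φ (O * φ) with hc
  set O' : GaugeConfig 3 L SU2 → ℝ := O - fun _ => c with hO'def
  have hins : ins φ O = O' * φ := PolyakovLift.ins_eq_sub_const_mul φ O
  have hO' : IsPhys O' := isPhys_sub hO (isPhys_const _)
  have hinc : ∀ U V, O' U - O' V = O U - O V := fun U V => by simp only [hO'def, Pi.sub_apply]; ring
  rw [hins, residual_eq_dirichlet β hφ hO' heig a]
  simp_rw [hinc]

/-! ## §3 Euclidean reading: the residual of a vacuum-subtracted insertion in the lead's `corr` currency (append, same seat) -/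

/-- ★ **`‖(K_β − a)·ins φ G_i‖² = λ₀²·(corr₂ − 2(a/λ₀)·corr₁ + (a/λ₀)²·corr₀)`**, `corr_t = corr β φ G t i i = ⟨ins φ G_i, K_β^t ins φ G_i⟩/λ₀^t`
(`λ₀ > 0` always): a quasimode bound `‖(K_β − a)v‖² ≤ η²λ₀²‖v‖²` for `v = ins φ G_i` IS the inequality `corr₂ − 2r·corr₁ + r²·corr₀ ≤ η²·corr₀`, `r = a/λ₀`,
on the UNDRESSED two-point function at Euclidean times `0, 1, 2` (so `PolyakovLift.ShadowQuasimodeAt` is a statement about three slab numbers).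
[cite: SeilerLNP1982, §3] [cite: Kato1949, §1] -/
theorem residual_ins_eq_corr {k : ℕ} (β : ℝ) {φ : GaugeConfig 3 L SU2 → ℝ} (hφ : IsPhys φ)
    {G : Fin k → (GaugeConfig 3 L SU2 → ℝ)} (hG : ∀ i, IsPhys (G i)) (i : Fin k) (a : ℝ) :
    l2 (transferApply β (ins φ (G i)) - a • ins φ (G i)) (transferApply β (ins φ (G i)) - a • ins φ (G i)) =
      levelValue su2Rep L β 0 ^ 2 *
        (PolyakovLift.corr β φ G 2 i i - 2 * (a / levelValue su2Rep L β 0) * PolyakovLift.corr β φ G 1 i i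
          + (a / levelValue su2Rep L β 0) ^ 2 * PolyakovLift.corr β φ G 0 i i) := by
  have hv : IsPhys (ins φ (G i)) := isPhys_ins hφ (hG i)
  have hl0 : 0 < levelValue su2Rep L β 0 := levelValue_zero_su2Rep_pos L β
  rw [LiftLeak.residual_expand β hv a]
  have h2 : l2 (transferApply β (ins φ (G i))) (transferApply β (ins φ (G i))) =
      l2 (ins φ (G i)) ((transferApply β)^[2] (ins φ (G i))) := by
    have := PolyakovLift.l2_iterate_polar β hv hv 1 1
    simpa only [Function.iterate_one] using this
  have hc : ∀ t : ℕ, l2 (ins φ (G i)) ((transferApply β)^[t] (ins φ (G i))) = levelValue su2Rep L β 0 ^ t * PolyakovLift.corr β φ G t i i :=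
    fun t => by
    unfold PolyakovLift.corr
    rw [mul_div_cancel₀ _ (pow_ne_zero t hl0.ne')]
  have h1 : l2 (ins φ (G i)) (transferApply β (ins φ (G i))) = levelValue su2Rep L β 0 ^ 1 * PolyakovLift.corr β φ G 1 i i := by
    rw [← hc 1, Function.iterate_one]
  have h0 : l2 (ins φ (G i)) (ins φ (G i)) = levelValue su2Rep L β 0 ^ 0 * PolyakovLift.corr β φ G 0 i i := by
    rw [← hc 0, Function.iterate_zero, id_eq]
  rw [h2, hc 2, h1, h0]
  field_simp

end Femto

end Summit.QuantumFields.YangMills.Theorems.FemtoTransferGap.LiftPos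

end
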